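import Literature.NumberTheory.Automorphic.CentralEigensystemComplex
import HarnessLib

/-!
# The central Hecke eigensystem of a twisted cohomology class is an algebraic Größencharakter
# (generic form, for any arithmetic datum `Γ → GL_n(𝔸_F^∞)`)

Topic `NumberTheory/Automorphic`; namespace `Literature.NumberTheory.Automorphic`, grouping
sub-namespace `TwistedQuotient` (the generic layer of `CuspidalCohomologyGL`).  Theorems only (no
definition, no named fact, no instance, no `sorry`).

`CentralEigensystemGrossencharakter` / `CentralEigensystemComplex` prove, for the parallel-weight
receptacle `H^q(GL_n(F), Fun(GL_n(𝔸_F^∞)/U, V_wt))` of `BianchiOrdinaryClassicality`, that the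
eigenvalues `a(w)` of the CENTRAL Hecke operators `T_{ϖ_w · 1}` on a non-zero class form an
algebraic Größencharakter.  The argument only uses the generic structure of twisted cohomology
`H^q(Γ, Fun(GL_n(𝔸_F^∞) ⧸ L, V))` (`TwistedQuotient.cohomology ι L ρ q` for ANY group `Γ`, any
`ι : Γ →* GL_n(𝔸_F^∞)`, any level `L ⊇ K_f(𝔫)` and any representation `ρ` of `Γ` on `V`) together
with ONE input from the datum: the principal scalars `x · 1`, `x ∈ F^×`, are images `ι(z_x)` of
CENTRAL elements `z_x ∈ Z(Γ)` acting on `V` by scalars `ω(x)` (the central character of the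
coefficients).  This file records the argument in that generality, so that it serves every
receptacle at once — in particular `ResGLnCohomology.levelCohomology` (`Γ = GL_n(K)⁺`,
`E_λ = ⊗_τ V_{λ_τ}` of non-parallel weight; `ResGLnCentralEigensystem`):

* `TwistedQuotient.centralEigenvalue_ne_zero`, `heckeEnd_centralIdeleOf_apply`,
  `eigenvalueProd_ne_zero'` — the central operators are invertible and multiplicative, so
  `T_{Z_x} ξ = A(x) ξ` with `A(x) = ∏_{w ∣ x} a(w)^{ord_w x} ≠ 0` (`Z_x = ∏_w t_{w,n}^{ord_w x}`,
  `BigHeckeGLn.centralIdeleOf`; `A = ParallelWeight.eigenvalueProd`);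
* `TwistedQuotient.centralEigensystem_mul_eq` — for non-zero `b ≡ c (mod 𝔫)` prime to `S` and
  `𝔫`: **`A(b) ω(c) = A(c) ω(b)`** (the unit parts `u_x = (x·1) Z_x⁻¹` of `b` and `c` differ by an
  element of `K_f(𝔫)`, `BigHeckeGLn.unitPart_quotient_mem`; `T_{x·1} = ω(x)` because central
  elements of `Γ` act trivially on `H^q(Γ, ·)`, `TwistedQuotient.heckeEnd_apply_of_mem_center`);
* `TwistedQuotient.isGrossencharakter_centralEigensystem_of_types` — through `ι : E ≃+* ℂ`, if
  `ι(ω(x)) = ∏_w w(x)^{p_w} · conj(w(x))^{q_w}` for integers `p_w, q_w` indexed by the infinite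
  places, then `w ↦ ι(a(w))` is a Größencharakter modulo `𝔫 ∏_{w ∈ S} w` of type `(p, q)`
  (`Literature.NumberTheory.GaloisRepresentations.IsGrossencharakter`).

[cite: Harder1987, §2] (the central character of a Hecke eigensystem in the cohomology of an
arithmetic group is an algebraic Hecke character whose infinity type is that of the coefficients).

## References

* G. Harder, *Eisenstein cohomology of arithmetic groups. The case GL₂*, Invent. Math. 89 (1987), §2
  [Harder1987].
* J. Neukirch, *Algebraic Number Theory* (1999), Ch. VII §6 (Größencharaktere) [NeukirchANT1999].
-/

noncomputable section

open scoped NumberField ComplexConjugate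
open IsDedekindDomain NumberField

namespace Literature.NumberTheory.Automorphic

namespace TwistedQuotient

open BigHeckeGLn ParallelWeight Literature.NumberTheory.GaloisRepresentations

variable {E : Type} [Field E] {F : Type} [Field F] [NumberField F] {n : ℕ}
  {Γ : Type} [Group Γ] (ι : Γ →* FiniteAdelicGL n F) (L : Subgroup (FiniteAdelicGL n F))
  {V : Type} [AddCommGroup V] [Module E V] (ρ : Representation E Γ V) (q : ℕ)

/-! ### Central operators on a simultaneous eigenvector -/

/-- **Central eigenvalues are non-zero** (the central operators `T_{ϖ_w·1}` are invertible on
`H^q(Γ, Fun(GL_n(𝔸_F^∞) ⧸ L, V))`). [folklore] -/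
theorem centralEigenvalue_ne_zero {ξ : cohomology ι L ρ q} (hξ : ξ ≠ 0)
    {w : HeightOneSpectrum (𝓞 F)} {a : E}
    (h : heckeEnd ι L ρ (heckeElement n F w n) q ξ = a • ξ) : a ≠ 0 := by
  intro ha
  rw [ha, zero_smul] at h
  have hz := heckeElement_self_mem_center (n := n) (K := F) w
  have h1 : heckeEnd ι L ρ ((heckeElement n F w n)⁻¹ * heckeElement n F w n) q ξ = ξ := by
    rw [inv_mul_cancel]
    exact heckeEnd_eq_id_of_mem_center_of_mem ι L ρ (Subgroup.one_mem _) (one_mem L) q ξ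
  rw [heckeEnd_mul_of_mem_center ι L ρ (inv_mem hz) hz, h, map_zero] at h1
  exact hξ h1.symm

/-- Powers of a central operator on an eigenvector. [folklore] -/
theorem heckeEnd_pow_central_apply {g : FiniteAdelicGL n F} (hg : g ∈ Subgroup.center _)
    {ξ : cohomology ι L ρ q} {a : E} (h : heckeEnd ι L ρ g q ξ = a • ξ) (k : ℕ) :
    heckeEnd ι L ρ (g ^ k) q ξ = a ^ k • ξ := by
  induction k with
  | zero =>
    rw [pow_zero, pow_zero, one_smul]
    exact heckeEnd_eq_id_of_mem_center_of_mem ι L ρ (Subgroup.one_mem _) (one_mem L) q ξ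
  | succ k ih =>
    rw [pow_succ, heckeEnd_mul_of_mem_center ι L ρ (pow_mem hg k) hg, h, map_smul, ih,
      smul_smul, pow_succ, mul_comm]

/-- **A list product of powers of central operators** acts on a simultaneous eigenvector by the
product of the powers of the eigenvalues. [folklore] -/
theorem heckeEnd_list_prod_central_apply (e : HeightOneSpectrum (𝓞 F) → ℕ)
    {ξ : cohomology ι L ρ q} {a : HeightOneSpectrum (𝓞 F) → E} :
    ∀ l : List (HeightOneSpectrum (𝓞 F)),
      (∀ w ∈ l, heckeEnd ι L ρ (heckeElement n F w n) q ξ = a w • ξ) →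
      heckeEnd ι L ρ ((l.map fun w => heckeElement n F w n ^ e w).prod) q ξ =
        (l.map fun w => a w ^ e w).prod • ξ
  | [], _ => by
    rw [List.map_nil, List.map_nil, List.prod_nil, List.prod_nil, one_smul]
    exact heckeEnd_eq_id_of_mem_center_of_mem ι L ρ (Subgroup.one_mem _) (one_mem L) q ξ
  | w :: l, h => by
    rw [List.map_cons, List.map_cons, List.prod_cons, List.prod_cons,
      heckeEnd_mul_of_mem_center ι L ρ (pow_mem (heckeElement_self_mem_center w) _)
        (list_prod_mem_center _ fun g hg => by
          obtain ⟨v, -, rfl⟩ := List.mem_map.1 hg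
          exact pow_mem (heckeElement_self_mem_center v) _),
      heckeEnd_list_prod_central_apply e l (fun v hv => h v (List.mem_cons_of_mem w hv)), map_smul,
      heckeEnd_pow_central_apply ι L ρ q (heckeElement_self_mem_center w) (h w List.mem_cons_self),
      smul_smul, mul_comm]

/-- **`T_{Z_x} ξ = A(x) ξ`** for `x` prime to `S`, `Z_x = ∏_{w ∣ x} t_{w,n}^{ord_w x}`,
`A(x) = ∏_{w ∣ x} a(w)^{ord_w x}`. [folklore] -/
theorem heckeEnd_centralIdeleOf_apply {S : Set (HeightOneSpectrum (𝓞 F))}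
    {ξ : cohomology ι L ρ q} {a : HeightOneSpectrum (𝓞 F) → E}
    (heig : ∀ w, w ∉ S → heckeEnd ι L ρ (heckeElement n F w n) q ξ = a w • ξ)
    (x : 𝓞 F) (hx : x ≠ 0) (hxS : ∀ w, w.asIdeal ∣ Ideal.span {x} → w ∉ S) :
    heckeEnd ι L ρ (centralIdeleOf x hx) q ξ = eigenvalueProd a x hx • ξ := by
  have hI : Ideal.span {x} ≠ 0 := by rw [Ne, Ideal.zero_eq_bot, Ideal.span_singleton_eq_bot]; exact hx
  have heq : (centralIdeleOf (n := n) x hx) =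
      (((Ideal.finite_factors hI).toFinset.toList).map fun w => heckeElement n F w n ^ ordAt w x).prod := by
    rw [centralIdeleOf]
    congr 1
    refine List.map_congr_left fun w _ => ?_
    exact ofLocal_centralLocal x w
  rw [heq, eigenvalueProd]
  exact heckeEnd_list_prod_central_apply ι L ρ q _ _ fun w hw => heig w (hxS w
    ((Ideal.finite_factors hI).mem_toFinset.1 (Finset.mem_toList.1 hw)))

/-- `A(x) ≠ 0`. [folklore] -/
theorem eigenvalueProd_ne_zero' {S : Set (HeightOneSpectrum (𝓞 F))}
    {ξ : cohomology ι L ρ q} (hξ : ξ ≠ 0) {a : HeightOneSpectrum (𝓞 F) → E}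
    (heig : ∀ w, w ∉ S → heckeEnd ι L ρ (heckeElement n F w n) q ξ = a w • ξ)
    (x : 𝓞 F) (hx : x ≠ 0) (hxS : ∀ w, w.asIdeal ∣ Ideal.span {x} → w ∉ S) :
    eigenvalueProd a x hx ≠ 0 := by
  have hI : Ideal.span {x} ≠ 0 := by rw [Ne, Ideal.zero_eq_bot, Ideal.span_singleton_eq_bot]; exact hx
  rw [eigenvalueProd]
  refine List.prod_ne_zero fun h0 => ?_
  obtain ⟨w, hw, hw0⟩ := List.mem_map.1 h0
  have hwS := hxS w ((Ideal.finite_factors hI).mem_toFinset.1 (Finset.mem_toList.1 hw))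
  exact pow_ne_zero _ (centralEigenvalue_ne_zero ι L ρ q hξ (heig w hwS)) hw0

/-! ### Global scalars through central elements of `Γ` -/

/-- **`T_{u_x} ξ = ω A(x)⁻¹ ξ`** for the unit part `u_x = (x · 1) Z_x⁻¹`, when `x · 1 = ι(z)` for a
central `z ∈ Γ` acting on `V` by the scalar `ω`. [cite: Harder1987, §2] -/
theorem heckeEnd_unitPart_apply {S : Set (HeightOneSpectrum (𝓞 F))}
    {ξ : cohomology ι L ρ q} (hξ : ξ ≠ 0) {a : HeightOneSpectrum (𝓞 F) → E}
    (heig : ∀ w, w ∉ S → heckeEnd ι L ρ (heckeElement n F w n) q ξ = a w • ξ)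
    (x : 𝓞 F) (hx : x ≠ 0) (hxS : ∀ w, w.asIdeal ∣ Ideal.span {x} → w ∉ S)
    {z : Γ} (hzΓ : z ∈ Subgroup.center Γ)
    (hιz : ι z = globalEmbedding n F (Matrix.GeneralLinearGroup.scalar (Fin n) (unitOf x hx)))
    {ω : E} (hω : ∀ v : V, ρ z v = ω • v) :
    heckeEnd ι L ρ (globalEmbedding n F (Matrix.GeneralLinearGroup.scalar (Fin n) (unitOf x hx)) *
        (centralIdeleOf x hx)⁻¹) q ξ =
      (ω * (eigenvalueProd a x hx)⁻¹) • ξ := by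
  have hZ := centralIdeleOf_mem_center (n := n) x hx
  have hA0 := eigenvalueProd_ne_zero' ι L ρ q hξ heig x hx hxS
  have hsc : heckeEnd ι L ρ (globalEmbedding n F (Matrix.GeneralLinearGroup.scalar (Fin n) (unitOf x hx)))
      q ξ = ω • ξ := by
    rw [← hιz]
    exact heckeEnd_apply_of_mem_center ι L ρ hzΓ (by rw [hιz]; exact globalEmbedding_scalar_mem_center _)
      hω q ξ
  have hinv : heckeEnd ι L ρ ((centralIdeleOf x hx)⁻¹) q ξ = (eigenvalueProd a x hx)⁻¹ • ξ := by
    have h := heckeEnd_mul_of_mem_center ι L ρ (inv_mem hZ) hZ q ξ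
    rw [inv_mul_cancel, heckeEnd_eq_id_of_mem_center_of_mem ι L ρ (Subgroup.one_mem _) (one_mem L),
      heckeEnd_centralIdeleOf_apply ι L ρ q heig x hx hxS, map_smul] at h
    have h' := congrArg (fun y => (eigenvalueProd a x hx)⁻¹ • y) h
    simp only [smul_smul, inv_mul_cancel₀ hA0, one_smul] at h'
    exact h'.symm
  have hcomm : globalEmbedding n F (Matrix.GeneralLinearGroup.scalar (Fin n) (unitOf x hx)) *
      (centralIdeleOf x hx)⁻¹ =
      (centralIdeleOf x hx)⁻¹ * globalEmbedding n F (Matrix.GeneralLinearGroup.scalar (Fin n) (unitOf x hx)) :=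
    Subgroup.mem_center_iff.1 (inv_mem hZ) _
  rw [hcomm, heckeEnd_mul_of_mem_center ι L ρ (inv_mem hZ) (globalEmbedding_scalar_mem_center _),
    hsc, map_smul, hinv, smul_smul, mul_comm]

/-- **The central eigensystem is a Größencharakter** (`E`-valued form, generic).  Let
`ξ ≠ 0` in `H^q(Γ, Fun(GL_n(𝔸_F^∞) ⧸ L, V))` with `T_{ϖ_w·1} ξ = a(w) ξ` for `w ∉ S`, `K_f(𝔫) ≤ L`,
and non-zero `b, c ∈ 𝓞 F` prime to `S` and to `𝔫` with `b ≡ c (mod 𝔫)`; assume `b · 1 = ι(z_b)`,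
`c · 1 = ι(z_c)` for central `z_b, z_c ∈ Γ` acting on `V` by the scalars `ω_b, ω_c`.  Then
`A(b) · ω_c = A(c) · ω_b`, `A(x) = ∏_{w ∣ x} a(w)^{ord_w x}`. [cite: Harder1987, §2] -/
theorem centralEigensystem_mul_eq {𝔫 : Ideal (𝓞 F)} (h𝔫 : 𝔫 ≠ 0)
    (hL : (principalCongruenceLevel n F 𝔫).comap (GLn.ofFinite n F) ≤ L)
    (S : Set (HeightOneSpectrum (𝓞 F))) {ξ : cohomology ι L ρ q} (hξ : ξ ≠ 0)
    (a : HeightOneSpectrum (𝓞 F) → E)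
    (heig : ∀ w, w ∉ S → heckeEnd ι L ρ (heckeElement n F w n) q ξ = a w • ξ)
    {b c : 𝓞 F} (hb : b ≠ 0) (hc : c ≠ 0)
    (hbS : ∀ w, w.asIdeal ∣ Ideal.span {b} → w ∉ S ∧ ¬ w.asIdeal ∣ 𝔫)
    (hcS : ∀ w, w.asIdeal ∣ Ideal.span {c} → w ∉ S ∧ ¬ w.asIdeal ∣ 𝔫)
    (hbc : b - c ∈ 𝔫)
    {zb zc : Γ} (hzb : zb ∈ Subgroup.center Γ) (hzc : zc ∈ Subgroup.center Γ)
    (hιb : ι zb = globalEmbedding n F (Matrix.GeneralLinearGroup.scalar (Fin n) (unitOf b hb)))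
    (hιc : ι zc = globalEmbedding n F (Matrix.GeneralLinearGroup.scalar (Fin n) (unitOf c hc)))
    {ωb ωc : E} (hωb : ∀ v : V, ρ zb v = ωb • v) (hωc : ∀ v : V, ρ zc v = ωc • v) :
    eigenvalueProd a b hb * ωc = eigenvalueProd a c hc * ωb := by
  set ub : FiniteAdelicGL n F := globalEmbedding n F (Matrix.GeneralLinearGroup.scalar (Fin n) (unitOf b hb)) *
    (centralIdeleOf b hb)⁻¹ with hub
  set uc : FiniteAdelicGL n F := globalEmbedding n F (Matrix.GeneralLinearGroup.scalar (Fin n) (unitOf c hc)) *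
    (centralIdeleOf c hc)⁻¹ with huc
  have hub_c : ub ∈ Subgroup.center _ :=
    mul_mem (globalEmbedding_scalar_mem_center _) (inv_mem (centralIdeleOf_mem_center b hb))
  have huc_c : uc ∈ Subgroup.center _ :=
    mul_mem (globalEmbedding_scalar_mem_center _) (inv_mem (centralIdeleOf_mem_center c hc))
  have hk_L : uc⁻¹ * ub ∈ L :=
    hL (unitPart_quotient_mem h𝔫 hb hc (fun w hw => (hbS w hw).2) (fun w hw => (hcS w hw).2) hbc)
  have hk_c : uc⁻¹ * ub ∈ Subgroup.center _ := mul_mem (inv_mem huc_c) hub_c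
  -- compare `T_{u_b} ξ` and `T_{u_c} ξ`
  have h5 : heckeEnd ι L ρ ub q ξ = heckeEnd ι L ρ uc q ξ := by
    conv_lhs => rw [show ub = uc * (uc⁻¹ * ub) by group]
    rw [heckeEnd_mul_of_mem_center ι L ρ huc_c hk_c, heckeEnd_eq_id_of_mem_center_of_mem ι L ρ hk_c hk_L]
  rw [hub, huc, heckeEnd_unitPart_apply ι L ρ q hξ heig b hb (fun w hw => (hbS w hw).1) hzb hιb hωb,
    heckeEnd_unitPart_apply ι L ρ q hξ heig c hc (fun w hw => (hcS w hw).1) hzc hιc hωc] at h5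
  set Ab := eigenvalueProd a b hb
  set Ac := eigenvalueProd a c hc
  have h6 : ωb * Ab⁻¹ = ωc * Ac⁻¹ := by
    have h := sub_eq_zero.2 h5
    rw [← sub_smul, smul_eq_zero] at h
    exact sub_eq_zero.1 (h.resolve_right hξ)
  have hAb0 : Ab ≠ 0 := eigenvalueProd_ne_zero' ι L ρ q hξ heig b hb fun w hw => (hbS w hw).1
  have hAc0 : Ac ≠ 0 := eigenvalueProd_ne_zero' ι L ρ q hξ heig c hc fun w hw => (hcS w hw).1
  calc Ab * ωc = Ab * ωc * (Ac⁻¹ * Ac) := by rw [inv_mul_cancel₀ hAc0, mul_one]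
    _ = Ab * Ac * (ωc * Ac⁻¹) := by ring
    _ = Ab * Ac * (ωb * Ab⁻¹) := by rw [h6]
    _ = Ac * ωb * (Ab * Ab⁻¹) := by ring
    _ = Ac * ωb := by rw [mul_inv_cancel₀ hAb0, mul_one]

/-! ### Transport through `ι : E ≃+* ℂ`: the Größencharakter -/

/-- **The central eigensystem is an algebraic Größencharakter** (generic complex form).  Let
`ξ ≠ 0` in `H^q(Γ, Fun(GL_n(𝔸_F^∞) ⧸ L, V))` with `T_{ϖ_w·1} ξ = a(w) ξ` for `w ∉ S` (`S` finite),
`K_f(𝔫) ≤ L`, and suppose every principal scalar `x · 1`, `x ∈ F^×`, is `ι(z_x)` for a central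
`z_x ∈ Γ` acting on `V` by a scalar `ω(x)` with `ι_E(ω(x)) = ∏_w w(x)^{p_w} conj(w(x))^{q_w}`
(an algebraic character of type `(p, q)` through the field isomorphism `ι_E : E ≃+* ℂ`).  Then
`w ↦ ι_E(a(w))` is a Größencharakter modulo `𝔫 ∏_{w ∈ S} w` of infinity type `(p, q)`.
[cite: Harder1987, §2] [cite: NeukirchANT1999, Ch. VII §6 Def. (6.1)] -/
theorem isGrossencharakter_centralEigensystem_of_types (ιE : E ≃+* ℂ) {𝔫 : Ideal (𝓞 F)}
    (h𝔫 : 𝔫 ≠ 0) (hL : (principalCongruenceLevel n F 𝔫).comap (GLn.ofFinite n F) ≤ L)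
    {S : Set (HeightOneSpectrum (𝓞 F))} (hS : S.Finite) {ξ : cohomology ι L ρ q} (hξ : ξ ≠ 0)
    (a : HeightOneSpectrum (𝓞 F) → E)
    (heig : ∀ w, w ∉ S → heckeEnd ι L ρ (heckeElement n F w n) q ξ = a w • ξ)
    (z : Fˣ → Γ) (hz : ∀ x, z x ∈ Subgroup.center Γ)
    (hιz : ∀ x, ι (z x) = globalEmbedding n F (Matrix.GeneralLinearGroup.scalar (Fin n) x))
    (ω : Fˣ → E) (hω : ∀ x (v : V), ρ (z x) v = ω x • v) (p q' : InfinitePlace F → ℤ)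
    (hωpq : ∀ x : Fˣ, ιE (ω x) =
      ∏ w : InfinitePlace F, w.embedding (x : F) ^ p w * conj (w.embedding (x : F)) ^ q' w) :
    IsGrossencharakter (conductorOf 𝔫 hS) p q' (fun w => ιE (a w)) := by
  refine ⟨fun v hv => ?_, fun b c hb hc hcop hbc _ => ?_⟩
  · rw [map_ne_zero]
    exact centralEigenvalue_ne_zero ι L ρ q hξ (heig v (not_mem_and_not_dvd_of_not_le hS hv).1)
  · -- the prime factors of `b` and `c` avoid `S` and `𝔫`
    have hcS : ∀ w : HeightOneSpectrum (𝓞 F), w.asIdeal ∣ Ideal.span {c} → w ∉ S ∧ ¬ w.asIdeal ∣ 𝔫 :=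
      fun w hw => not_mem_and_not_dvd_of_not_le hS (not_le_of_dvd_span_of_isCoprime hcop hw)
    have hbS : ∀ w : HeightOneSpectrum (𝓞 F), w.asIdeal ∣ Ideal.span {b} → w ∉ S ∧ ¬ w.asIdeal ∣ 𝔫 := by
      intro w hw
      refine not_mem_and_not_dvd_of_not_le hS fun hle => ?_
      refine not_le_of_dvd_span_of_isCoprime hcop (w := w) ?_ hle
      rw [Ideal.dvd_span_singleton]
      have hb' : b ∈ w.asIdeal := Ideal.dvd_span_singleton.1 hw
      have : b - (b - c) ∈ w.asIdeal := sub_mem hb' (hle hbc)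
      rwa [sub_sub_cancel] at this
    have hbc' : b - c ∈ 𝔫 := Ideal.mul_le_right hbc
    have key := centralEigensystem_mul_eq ι L ρ q h𝔫 hL S hξ a heig hb hc hbS hcS hbc'
      (hz (unitOf b hb)) (hz (unitOf c hc)) (hιz _) (hιz _) (hω _) (hω _)
    have key' := congrArg ιE key
    rw [map_mul, map_mul, map_eigenvalueProd, map_eigenvalueProd, hωpq, hωpq] at key'
    -- `W(b/c) = W(b) / W(c)`
    have hWc : (∏ w : InfinitePlace F, w.embedding ((unitOf c hc : Fˣ) : F) ^ p w *
        conj (w.embedding ((unitOf c hc : Fˣ) : F)) ^ q' w) ≠ 0 :=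
      Finset.prod_ne_zero_iff.2 fun w _ => mul_ne_zero
        (zpow_ne_zero _ (by rw [map_ne_zero]; exact (unitOf c hc).ne_zero))
        (zpow_ne_zero _ (by rw [map_ne_zero, map_ne_zero]; exact (unitOf c hc).ne_zero))
    have hdiv : (∏ w : InfinitePlace F, w.embedding ((b : F) / c) ^ p w *
          conj (w.embedding ((b : F) / c)) ^ q' w) =
        (∏ w : InfinitePlace F, w.embedding ((unitOf b hb : Fˣ) : F) ^ p w *
            conj (w.embedding ((unitOf b hb : Fˣ) : F)) ^ q' w) /
          ∏ w : InfinitePlace F, w.embedding ((unitOf c hc : Fˣ) : F) ^ p w *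
            conj (w.embedding ((unitOf c hc : Fˣ) : F)) ^ q' w := by
      rw [← Finset.prod_div_distrib]
      refine Finset.prod_congr rfl fun w _ => ?_
      rw [map_div₀, map_div₀, div_zpow, div_zpow, mul_div_mul_comm]
      rfl
    rw [hdiv, mul_div_assoc', eq_div_iff hWc, key']

end TwistedQuotient

end Literature.NumberTheory.Automorphic

end
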